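import Summits.RiemannHypothesis.RiemannHypothesis.Theses.WeilWindowFlow
import Literature.NumberTheory.LFunctions.WeilMarkovQuadratic
import Literature.NumberTheory.LFunctions.WeilGroundState

/-!
# Sketch — crux `WindowLipschitz` (stmt-RiemannHypothesis-1039), crux-ideate round 1, ideator 1

First lemmas of the three idea cards (Ideas/cut-dont-squeeze.md, Ideas/ladder-height-edge-law.md,
Ideas/borderline-barrier.md), stated as `Prop`s over existing declarations only. Nothing is proved.
-/

noncomputable section

open MeasureTheory Set Filter
open scoped Topology ContDiff ENNReal

namespace Summit.RiemannHypothesis.RiemannHypothesis.Cruxes.WindowLipschitz.Sketch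

open Literature.NumberTheory.LFunctions
open Summit.RiemannHypothesis.RiemannHypothesis.Theses.WeilWindowFlow (WindowLipschitz)

/-! ## Card `cut-dont-squeeze` -/

/-- FIRST LEMMA of card `cut-dont-squeeze` (provable now, pure quadratic-form algebra):
the ground-state substitution / CUT INEQUALITY for smooth near-minimisers.
If `g` is a test function on the window `[-a,a]` with `Re Q(g) ≤ (ε(a)+η)‖g‖²` and `χ` is a smooth
cutoff with values in `[0,1]` such that `χ g` lives on the smaller window `[-b,b]`, then
`(ε(b) − ε(a)) ‖χg‖² ≤ (√(η‖g‖²) + √(Re Q((1−χ)g) − ε(a)‖(1−χ)g‖²))²`.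
Proof idea: `B_ε := Re Q − ε(a)‖·‖²` is a positive semidefinite hermitian form on window-`a` test
functions (definition of `ε(a)` as an infimum); Cauchy–Schwarz for `B_ε(g, (1−χ)g)` and
`ε(b)‖χg‖² ≤ Re Q(χg)` (definition of `ε(b)`). For an exact minimiser (`η = 0`) this is the
IMS/ground-state-substitution identity `Q(g−r) − ε‖g−r‖² = Q(r) − ε‖r‖²`, `r = (1−χ)g`. -/
def CutInequality : Prop :=
  ∀ (a b η : ℝ) (g : ℝ → ℂ) (χ : ℝ → ℝ), 0 < b → b ≤ a → 0 ≤ η →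
    IsWeilTest g → tsupport g ⊆ Icc (-a) a →
    ContDiff ℝ ∞ χ → (∀ x, 0 ≤ χ x ∧ χ x ≤ 1) →
    tsupport (fun x ↦ (χ x : ℂ) * g x) ⊆ Icc (-b) b →
    (weilQuadratic g).re ≤ (weilGroundEnergy a + η) * ∫ x, ‖g x‖ ^ 2 →
    (weilGroundEnergy b - weilGroundEnergy a) * ∫ x, ‖(χ x : ℂ) * g x‖ ^ 2 ≤
      (Real.sqrt (η * ∫ x, ‖g x‖ ^ 2) +
        Real.sqrt ((weilQuadratic (fun x ↦ ((1 - χ x : ℝ) : ℂ) * g x)).re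
          - weilGroundEnergy a * ∫ x, ‖((1 - χ x : ℝ) : ℂ) * g x‖ ^ 2)) ^ 2

/-- Existence of ground states (Bombieri 2000 Thm 3; CCM25/Suzuki 2026 Thm 1.1: discrete spectrum). -/
def GroundStateExists : Prop :=
  ∀ a : ℝ, 0 < a → ∃ u : ℝ → ℂ, IsWeilGroundState a u

/-- EDGE-MASS LAW (what the cut inequality consumes): the `L²`-mass of a ground state within `h`
of the window edge is `O(h / log(1/h))`, uniformly for windows in a compact range. -/
def EdgeMassLaw : Prop :=
  ∀ b₀ A : ℝ, 0 < b₀ → b₀ ≤ A → ∃ C h₀ : ℝ, 0 < h₀ ∧ h₀ < 1 ∧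
    ∀ (a h : ℝ) (u : ℝ → ℂ), b₀ ≤ a → a ≤ A → IsWeilGroundState a u → 0 < h → h ≤ h₀ →
      (∫ x in {x : ℝ | a - h < |x|}, ‖u x‖ ^ 2) * Real.log (1 / h) ≤ C * h

/-- EDGE LOCAL-ENERGY LAW (second input of the cut; expected from `EdgeMassLaw` by a nonlocal
Caccioppoli inequality): the archimedean jump energy of a ground state at scales `< h`, localised
to the `2h`-edge-layer, is `O(h)`. Stated with `∫⁻` to be junk-free. -/
def EdgeLocalEnergyLaw : Prop :=
  ∀ b₀ A : ℝ, 0 < b₀ → b₀ ≤ A → ∃ C h₀ : ℝ, 0 < h₀ ∧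
    ∀ (a h : ℝ) (u : ℝ → ℂ), b₀ ≤ a → a ≤ A → IsWeilGroundState a u → 0 < h → h ≤ h₀ →
      (∫⁻ x in {x : ℝ | a - 2 * h < |x|}, ∫⁻ t in Ioo (-h) h,
          ENNReal.ofReal (weilArchDensity |t| * ‖u (x + t) - u x‖ ^ 2)) ≤ ENNReal.ofReal (C * h)

/-- The composition the card proposes (shape of the future skeleton `WindowLipschitz_of`). -/
def CutReduction : Prop :=
  GroundStateExists → EdgeMassLaw → EdgeLocalEnergyLaw → WindowLipschitz

/-! ## Card `ladder-height-edge-law` -/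

/-- UNIFORM SUP BOUND of ground states on compact window ranges (route: ultracontractivity of the
archimedean Lévy semigroup after finite time, `e^{-tψ(ξ)} ≍ |ξ|^{-t}` integrable for `t > 1`). -/
def GroundStateSupBound : Prop :=
  ∀ b₀ A : ℝ, 0 < b₀ → b₀ ≤ A → ∃ C : ℝ, ∀ (a : ℝ) (u : ℝ → ℂ), b₀ ≤ a → a ≤ A →
    IsWeilGroundState a u → ∀ᵐ x : ℝ, ‖u x‖ ≤ C

/-- FIRST LEMMA of card `ladder-height-edge-law` (provable now from digamma asymptotics
`Re ψ(1/4 + iξ/2) = log|ξ| − log 2 + O(ξ⁻²)`): the archimedean heat kernel is bounded after finite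
time, i.e. `ξ ↦ exp(−t (Re ψ(1/4+iξ/2) − ψ(1/4)))` is integrable for `t > t₀`. This is the
ultracontractivity input for `GroundStateSupBound`. -/
def ArchHeatKernelBounded : Prop :=
  ∃ t₀ : ℝ, 0 < t₀ ∧ ∀ t : ℝ, t₀ < t →
    Integrable fun ξ : ℝ ↦ Real.exp (-t * ((Complex.digamma (1 / 4 + (ξ / 2 : ℝ) * Complex.I)).re
        - (Complex.digamma (1 / 4)).re))

/-- SHARP POINTWISE EDGE LAW (exponent `1/2`), uniform on compact window ranges: the target the
fluctuation-theory engine delivers (`|u(x)| ≤ ‖F‖_∞ · E_x τ ≤ ‖F‖_∞ V(a−|x|) V(2a)`,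
`V(r) ≍ (log(1/r))^{-1/2}` = renewal function of the ladder-height process). Implies `EdgeMassLaw`
by integration (`∫₀ʰ ds / log(1/s) ≤ 2h / log(1/h)` for `h ≤ e⁻²`). -/
def EdgeLaw : Prop :=
  ∀ b₀ A : ℝ, 0 < b₀ → b₀ ≤ A → ∃ C d₀ : ℝ, 0 < d₀ ∧ d₀ < 1 ∧
    ∀ (a : ℝ) (u : ℝ → ℂ), b₀ ≤ a → a ≤ A → IsWeilGroundState a u →
      ∀ᵐ x : ℝ, a - d₀ < |x| → |x| < a → ‖u x‖ ^ 2 * Real.log (1 / (a - |x|)) ≤ C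

/-- `EdgeLaw → EdgeMassLaw` is elementary real analysis (recorded as the first glue step). -/
def EdgeLaw_to_EdgeMassLaw : Prop := EdgeLaw → EdgeMassLaw

/-! ## Card `borderline-barrier` -/

/-- The two-scale barrier profile: `(log(1/(a−|x|)))^{-1/2}` in the layer, frozen at depth `d₀`,
zero off the window. -/
def barrier (a d₀ x : ℝ) : ℝ :=
  if |x| < a then min (1 / Real.sqrt (Real.log (1 / (a - |x|)))) (1 / Real.sqrt (Real.log (1 / d₀)))
  else 0

/-- FIRST LEMMA of card `borderline-barrier` (a calculus statement about one explicit function):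
the archimedean jump operator applied to the two-scale barrier has a POSITIVE SURPLUS
`≥ c √(log(1/d₀))` throughout the deep layer `a − d₀⁴ < |y| < a`, for all small `d₀` and all
windows in a compact range. (At exponent `τ < 1/2` the surplus of `(log 1/d)^{-τ}` is
`∝ (1−2τ)(log 1/d)^{1−τ}`; at `τ = 1/2` it vanishes to leading order and the truncation at depth
`d₀` restores it.) With `GroundStateSupBound` and the weak maximum principle this gives `EdgeLaw`. -/
def BorderlineBarrierSurplus : Prop :=
  ∀ b₀ A : ℝ, 0 < b₀ → b₀ ≤ A → ∃ c d₁ : ℝ, 0 < c ∧ 0 < d₁ ∧ d₁ < 1 ∧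
    ∀ d₀ : ℝ, 0 < d₀ → d₀ ≤ d₁ → ∀ a : ℝ, b₀ ≤ a → a ≤ A →
      ∀ y : ℝ, a - d₀ ^ 4 < |y| → |y| < a →
        c * Real.sqrt (Real.log (1 / d₀)) ≤
          ∫ t : ℝ, (barrier a d₀ y - barrier a d₀ (y + t)) * weilArchDensity |t|

end Summit.RiemannHypothesis.RiemannHypothesis.Cruxes.WindowLipschitz.Sketch
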